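import Summits.HodgeConjecture.CorCM.StabiliserOrbitSelfConjugate
import Summits.HodgeConjecture.CorCM.PairFlipCMFieldOrbitCriterion
import Summits.HodgeConjecture.CorCM.DoubleFlipCMFieldsHodge
import HarnessLib

/-!
# A CM field with self-conjugate stabiliser orbits against ANY partner: the coefficient criterion, the orbit criterion,
# and smaller partners — `Hg(A₀ × A₁) = Hg(A₀) × Hg(A₁)` decided for every (SC) factor

COR-CM (cell `pub-hodgecm2`, binder seat `b16` gen 54, count-neutral claim STAB-CONJ, file F3; theorems only, no
definition, no named fact, no `sorry`).  NEW as stated, hence under `Summits/`.  HONEST FRAMING: statements about pairs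
of CM types and products of two CM abelian varieties; `HC_CM` is neither used nor asserted — «HC for NAMED classes».

This seat's exact two-slot criteria (gens 51–53) — Goursat's dichotomy (`PairFlipTransportDichotomy`), the matrix-
coefficient criterion (`PairFlipSlotCoefficientCriterion`), the stabiliser-orbit criterion (`StabiliserOrbitKernel`,
`StabiliserOrbitCriterion`) and the smaller-partner theorem (`DoubleFlipCMFieldsHodge`, p2's `CMTypeRankIrreducibleSlot`)
— all run on ONE input about the base slot: `U(Φ₀)` is an IRREDUCIBLE `Aut(ℂ)`-module (`hirr`), plus nondegeneracy of
`Φ₀`.  They were dressed for base fields with PAIR FLIPS (and, for the smaller-partner theorem, DOUBLE FLIPS).  F1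
(`StabiliserOrbitSelfConjugate`) derives `hirr` and nondegeneracy from the weaker and EXACT hypothesis

  (SC)  `∀ x₀ x : K_{i₀} → ℂ, x ∉ {x₀, x̄₀} → ∃ σ ∈ Aut(ℂ), σ ∘ x₀ = x₀ ∧ σ ∘ x = x̄`

(equivalent to multiplicity one of the odd weights; field test `x₀(K) ⊄ x(K)·x₀(K⁺)`, F2).  This file is the dress for an
(SC) base field `K_{i₀}` against ANY CM field `K_{i₁}` (any degree, any position), `I = {i₀, i₁}`:

* §1 `irreducible_and_isNondegenerate_of_stabConj`; **`cmFamilyRank_add_card_eq_iff_not_exists_coeff_of_stabConj`** /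
  **`isNondegenerateFamily_iff_not_exists_coeff_of_stabConj`** — additive (`Hg(A₀ × A₁) = Hg(A₀) × Hg(A₁)`) IFF no
  `λ : Hom(K_{i₁}, ℂ) → ℚ` has `Σ_y λ(y) u_{Φ₁}(g ∘ y) = u_{Φ₀}(g ∘ x₀)` for all `g ∈ Aut(ℂ)`;
* §2 **`cmFamilyRank_add_card_eq_iff_not_exists_orbitCoeff_of_stabConj`** /
  **`isNondegenerateFamily_iff_not_exists_orbitCoeff_of_stabConj`** (`k` homogeneous sets `O_j` under `Aut(ℂ/x₀K_{i₀})`,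
  compositum test off them: additive IFF `u_{Φ₀}(· x₀)` is not a combination of the `k` orbit shadows), and the ONE-ORBIT
  forms **`cmFamilyRank_add_card_eq_iff_of_stabConj_of_orbit`** / **`isNondegenerateFamily_iff_of_stabConj_of_orbit`**
  (additive IFF the orbit multiplicities `#{y ∈ O : g ∘ y ∈ Φ₁}` are NOT `a` on `Φ₀`, `b` off `Φ₀`, `a ≠ b`);
* §3 SMALLER PARTNERS: `pairwise_of_stabConj_of_finrank_lt` (no common constituent with any field of smaller degree) and
  **`isNondegenerateFamily_iff_of_stabConj_of_finrank_lt`** — `[K_{i₁}:ℚ] < [K_{i₀}:ℚ]` ⟹ the pair is nondegenerate IFF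
  `Φ₁` is (an (SC) field of degree `2n` pairs additively with every CM abelian variety of dimension `< n`);
* §4 abelian varieties: **`hodgeConjectureFor_prod_of_stabConj_of_orbit`**, `…_of_not_exists_coeff`,
  **`hodgeConjectureFor_prod_of_stabConj_of_dim_lt`** (the Hodge conjecture with `B• = D•` on every `A₀^a × A₁^b`,
  UNCONDITIONALLY, in the additive cases), **`forall_prod_hodgeClassSpan_eq_iff_of_stabConj_of_orbit`** (simple,
  non-isogenous: `B• = D•` on all products IFF …), `forall_prod_hodgeClassSpan_eq_iff_of_stabConj_coeff`.

## References

* [Gordon1999HodgeAVSurvey] B. B. Gordon, *A survey of the Hodge conjecture for abelian varieties*, §3 Theorem (Imai,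
  Murty) with proof, 7.4–7.7, 9.4.3, 10.10.
* [Serre1977] J.-P. Serre, *Linear Representations of Finite Groups*, GTM 42, §2.2, §7.2–7.4.
* [Dodson1984] B. Dodson, *The structure of Galois groups of CM-fields*, Trans. AMS 283 (1984), §1.1, §5.1.2.
* [Wielandt1964] H. Wielandt, *Finite Permutation Groups* (1964), Thm. 28.4.
-/

set_option autoImplicit false

noncomputable section

open scoped BigOperators

namespace Summit.HodgeConjecture.CorCM

open CategoryTheory CategoryTheory.Limits NumberField Module
open Literature.NumberTheory.ComplexMultiplication
open Literature.AlgebraicGeometry.Motives (AbelianVariety CMType)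
open Literature.AlgebraicGeometry.HodgeTheory
open Literature.AlgebraicGeometry.ComplexMultiplication (IsCMTypeRealisation)
open Literature.AlgebraicGeometry.VanGeemen1994 (hodgeClassSpan)
open Literature.AlgebraicGeometry.Pohlmann1968
open Literature.Barriers.HodgeConjecture (divisorClassesSpan)
open scoped Classical

variable {I : Type} {K : I → Type} [∀ i, Field (K i)] [∀ i, NumberField (K i)] [∀ i, IsCMField (K i)]

omit [∀ i, IsCMField (K i)] in
/-- `|⊔_i Hom(K_i, ℂ)| = Σ_i [K_i : ℚ]`. [folklore] -/
private theorem card_sigma_ringHom_eq_sum₅₄ [Fintype I] :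
    Fintype.card ((i : I) × (K i →+* ℂ)) = ∑ i, finrank ℚ (K i) := by
  rw [Fintype.card_sigma]
  exact Finset.sum_congr rfl fun i _ => Embeddings.card (K i) ℂ

/-! ### §1 Irreducibility and the coefficient criterion -/

section Coefficient

/-- **An (SC) slot: `U(Φ)` irreducible of dimension `[K:ℚ]/2`, `Φ` nondegenerate** — the three inputs of this seat's
two-slot criteria, for EVERY CM type of the field. [cite: Wielandt1964, Thm. 28.4] [cite: Serre1977, §2.2] -/
theorem irreducible_and_isNondegenerate_of_stabConj (Φ : ∀ i, CMType (K i)) {i : I}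
    (hSC : ∀ x₀ x : K i →+* ℂ, x ≠ x₀ → x ≠ (starRingAut : ℂ ≃+* ℂ) • x₀ →
      ∃ σ : ℂ ≃+* ℂ, σ • x₀ = x₀ ∧ σ • x = (starRingAut : ℂ ≃+* ℂ) • x) :
    (∀ W : Submodule ℚ ((K i →+* ℂ) → ℚ), W ≤ antiSpan (ℂ ≃+* ℂ) (Φ i).1 → W ≠ ⊥ →
      (∀ (k : ℂ ≃+* ℂ) (f : (K i →+* ℂ) → ℚ), f ∈ W → (fun y => f (k • y)) ∈ W) → W = antiSpan (ℂ ≃+* ℂ) (Φ i).1) ∧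
    finrank ℚ (antiSpan (ℂ ≃+* ℂ) (Φ i).1) = finrank ℚ (K i) / 2 ∧ IsNondegenerate (Φ i) := by
  haveI := isPretransitive_ringEquiv_complex (K := K i)
  have hnd : IsNondegenerate (Φ i) := by
    rw [isNondegenerate_iff, cmTypeRank, ← Embeddings.card (K i) ℂ]
    exact StabConj.typeRank_eq_of_stabConj (isCMTypeWith_conj (Φ i)) hSC
  exact ⟨StabConj.antiSpan_irreducible_of_stabConj (isCMTypeWith_conj (Φ i)) hSC,
    (finrank_antiSpan_eq_iff_isNondegenerate i).2 hnd, hnd⟩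

variable [Fintype I] [DecidableEq I] {Φ : ∀ i, CMType (K i)} {i₀ i₁ : I}

/-- **THE COEFFICIENT CRITERION for an (SC) field against ANY CM field (rank form).**  `I = {i₀, i₁}`, `K_{i₀}` with (SC),
`K_{i₁}` ANY CM field, `x₀ : K_{i₀} → ℂ` any embedding: `rank(Φ₀, Φ₁) + 2 = rank Φ₀ + rank Φ₁ + 1`
(`Hg(A₀ × A₁) = Hg(A₀) × Hg(A₁)`) IFF no `λ : Hom(K_{i₁}, ℂ) → ℚ` has `Σ_y λ(y) u_{Φ₁}(g ∘ y) = u_{Φ₀}(g ∘ x₀)` for all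
`g ∈ Aut(ℂ)`. [cite: Gordon1999HodgeAVSurvey, §3 Theorem (1) and 7.5–7.7] [cite: Serre1977, §7.2] -/
theorem cmFamilyRank_add_card_eq_iff_not_exists_coeff_of_stabConj (hI : ∀ i, i = i₀ ∨ i = i₁) (h01 : i₀ ≠ i₁)
    (hSC : ∀ x₀ x : K i₀ →+* ℂ, x ≠ x₀ → x ≠ (starRingAut : ℂ ≃+* ℂ) • x₀ →
      ∃ σ : ℂ ≃+* ℂ, σ • x₀ = x₀ ∧ σ • x = (starRingAut : ℂ ≃+* ℂ) • x) (x₀ : K i₀ →+* ℂ) :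
    CMAlgebra.cmFamilyRank Φ + Fintype.card I = (∑ i, cmTypeRank (Φ i)) + 1 ↔
      ¬ ∃ lam : (K i₁ →+* ℂ) → ℚ, ∀ g : ℂ ≃+* ℂ,
        ∑ y, lam y * antiVec (Φ i₁).1 (1 : ℂ ≃+* ℂ) (g • y) = antiVec (Φ i₀).1 (1 : ℂ ≃+* ℂ) (g • x₀) := by
  haveI : Nonempty I := ⟨i₀⟩
  exact Shadow.typeRank_sigmaType_add_card_eq_iff_not_exists_coeff (G := ℂ ≃+* ℂ) (Φ := fun i => (Φ i).1)
    (fun i => isCMTypeWith_conj (Φ i)) hI h01 (irreducible_and_isNondegenerate_of_stabConj Φ hSC).1 x₀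

/-- **Nondegeneracy form**: `K_{i₀}` with (SC), `K_{i₁}` any CM field: the pair `(Φ₀, Φ₁)` is nondegenerate IFF `Φ₁` is
nondegenerate and no coefficient vector `λ` exists. [cite: Gordon1999HodgeAVSurvey, 7.5–7.7] -/
theorem isNondegenerateFamily_iff_not_exists_coeff_of_stabConj (hI : ∀ i, i = i₀ ∨ i = i₁) (h01 : i₀ ≠ i₁)
    (hSC : ∀ x₀ x : K i₀ →+* ℂ, x ≠ x₀ → x ≠ (starRingAut : ℂ ≃+* ℂ) • x₀ →
      ∃ σ : ℂ ≃+* ℂ, σ • x₀ = x₀ ∧ σ • x = (starRingAut : ℂ ≃+* ℂ) • x) (x₀ : K i₀ →+* ℂ) :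
    CMAlgebra.IsNondegenerateFamily Φ ↔ IsNondegenerate (Φ i₁) ∧
      ¬ ∃ lam : (K i₁ →+* ℂ) → ℚ, ∀ g : ℂ ≃+* ℂ,
        ∑ y, lam y * antiVec (Φ i₁).1 (1 : ℂ ≃+* ℂ) (g • y) = antiVec (Φ i₀).1 (1 : ℂ ≃+* ℂ) (g • x₀) := by
  haveI := isPretransitive_ringEquiv_complex (K := K i₀)
  haveI : Nonempty I := ⟨i₀⟩
  have hnd₀ : typeRank (ℂ ≃+* ℂ) (Φ i₀).1 = Fintype.card (K i₀ →+* ℂ) / 2 + 1 :=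
    StabConj.typeRank_eq_of_stabConj (isCMTypeWith_conj (Φ i₀)) hSC
  have key := Shadow.typeRank_sigmaType_eq_iff_not_exists_coeff (G := ℂ ≃+* ℂ) (Φ := fun i => (Φ i).1)
    (fun i => isCMTypeWith_conj (Φ i)) hI h01 (irreducible_and_isNondegenerate_of_stabConj Φ hSC).1 hnd₀ x₀
  rw [CMAlgebra.isNondegenerateFamily_iff, ← card_sigma_ringHom_eq_sum₅₄ (K := K), isNondegenerate_iff, cmTypeRank,
    ← Embeddings.card (K i₁) ℂ]
  exact key

end Coefficient

/-! ### §2 The orbit criterion -/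

section Orbit

variable [Fintype I] [DecidableEq I] {Φ : ∀ i, CMType (K i)} {i₀ i₁ : I}

/-- **THE `k`-ORBIT CRITERION for an (SC) base (rank form)**: orbit data `(O_j)_j` at `x₀` — each `O_j` homogeneous
under `Aut(ℂ / x₀K_{i₀})`, separated, compositum test off `⋃_j (O_j ∪ Ō_j)`: additive IFF there are NO constants
`c_j ∈ ℚ` with `u_{Φ₀}(g ∘ x₀) = Σ_j c_j Σ_{y∈O_j} u_{Φ₁}(g ∘ y)` for all `g ∈ Aut(ℂ)`.
[cite: Gordon1999HodgeAVSurvey, §3 Theorem (1) and 7.5–7.7] [cite: Serre1977, §7.2–7.4] -/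
theorem cmFamilyRank_add_card_eq_iff_not_exists_orbitCoeff_of_stabConj (hI : ∀ i, i = i₀ ∨ i = i₁) (h01 : i₀ ≠ i₁)
    (hSC : ∀ x₀ x : K i₀ →+* ℂ, x ≠ x₀ → x ≠ (starRingAut : ℂ ≃+* ℂ) • x₀ →
      ∃ σ : ℂ ≃+* ℂ, σ • x₀ = x₀ ∧ σ • x = (starRingAut : ℂ ≃+* ℂ) • x)
    {x₀ : K i₀ →+* ℂ} {κ : Type} [Fintype κ] (O : κ → Set (K i₁ →+* ℂ))
    (hO : ∀ j, ∀ y ∈ O j, ∀ y' ∈ O j, ∃ g : ℂ ≃+* ℂ, g • x₀ = x₀ ∧ g • y = y')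
    (hdisj : ∀ j j', j ≠ j' → ∀ y ∈ O j, y ∉ O j' ∧ (starRingAut : ℂ ≃+* ℂ) • y ∉ O j')
    (hoff : ∀ y : K i₁ →+* ℂ, (∀ j, y ∉ O j ∧ (starRingAut : ℂ ≃+* ℂ) • y ∉ O j) →
      ∃ σ : ℂ ≃+* ℂ, σ • x₀ = (starRingAut : ℂ ≃+* ℂ) • x₀ ∧ σ • y = y) :
    CMAlgebra.cmFamilyRank Φ + Fintype.card I = (∑ i, cmTypeRank (Φ i)) + 1 ↔
      ¬ ∃ c : κ → ℚ, ∀ g : ℂ ≃+* ℂ, antiVec (Φ i₀).1 (1 : ℂ ≃+* ℂ) (g • x₀) =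
        ∑ j, c j * ∑ y ∈ Finset.univ.filter (fun y : K i₁ →+* ℂ => y ∈ O j),
          antiVec (Φ i₁).1 (1 : ℂ ≃+* ℂ) (g • y) := by
  haveI : Nonempty I := ⟨i₀⟩
  exact Shadow.typeRank_sigmaType_add_card_eq_iff_not_exists_orbitCoeff (G := ℂ ≃+* ℂ) (Φ := fun i => (Φ i).1)
    (fun i => isCMTypeWith_conj (Φ i)) hI h01 (irreducible_and_isNondegenerate_of_stabConj Φ hSC).1 O hO hdisj hoff

/-- **THE `k`-ORBIT CRITERION for an (SC) base (nondegeneracy form)**: the pair is nondegenerate IFF `Φ₁` is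
nondegenerate and no orbit constants exist. [cite: Gordon1999HodgeAVSurvey, 7.5–7.7] [cite: Serre1977, §7.2–7.4] -/
theorem isNondegenerateFamily_iff_not_exists_orbitCoeff_of_stabConj (hI : ∀ i, i = i₀ ∨ i = i₁) (h01 : i₀ ≠ i₁)
    (hSC : ∀ x₀ x : K i₀ →+* ℂ, x ≠ x₀ → x ≠ (starRingAut : ℂ ≃+* ℂ) • x₀ →
      ∃ σ : ℂ ≃+* ℂ, σ • x₀ = x₀ ∧ σ • x = (starRingAut : ℂ ≃+* ℂ) • x)
    {x₀ : K i₀ →+* ℂ} {κ : Type} [Fintype κ] (O : κ → Set (K i₁ →+* ℂ))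
    (hO : ∀ j, ∀ y ∈ O j, ∀ y' ∈ O j, ∃ g : ℂ ≃+* ℂ, g • x₀ = x₀ ∧ g • y = y')
    (hdisj : ∀ j j', j ≠ j' → ∀ y ∈ O j, y ∉ O j' ∧ (starRingAut : ℂ ≃+* ℂ) • y ∉ O j')
    (hoff : ∀ y : K i₁ →+* ℂ, (∀ j, y ∉ O j ∧ (starRingAut : ℂ ≃+* ℂ) • y ∉ O j) →
      ∃ σ : ℂ ≃+* ℂ, σ • x₀ = (starRingAut : ℂ ≃+* ℂ) • x₀ ∧ σ • y = y) :
    CMAlgebra.IsNondegenerateFamily Φ ↔ IsNondegenerate (Φ i₁) ∧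
      ¬ ∃ c : κ → ℚ, ∀ g : ℂ ≃+* ℂ, antiVec (Φ i₀).1 (1 : ℂ ≃+* ℂ) (g • x₀) =
        ∑ j, c j * ∑ y ∈ Finset.univ.filter (fun y : K i₁ →+* ℂ => y ∈ O j),
          antiVec (Φ i₁).1 (1 : ℂ ≃+* ℂ) (g • y) := by
  haveI := isPretransitive_ringEquiv_complex (K := K i₀)
  haveI : Nonempty I := ⟨i₀⟩
  have hnd₀ : typeRank (ℂ ≃+* ℂ) (Φ i₀).1 = Fintype.card (K i₀ →+* ℂ) / 2 + 1 :=
    StabConj.typeRank_eq_of_stabConj (isCMTypeWith_conj (Φ i₀)) hSC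
  have key := Shadow.typeRank_sigmaType_eq_iff_not_exists_orbitCoeff (G := ℂ ≃+* ℂ) (Φ := fun i => (Φ i).1)
    (fun i => isCMTypeWith_conj (Φ i)) hI h01 (irreducible_and_isNondegenerate_of_stabConj Φ hSC).1 hnd₀ O hO hdisj hoff
  rw [CMAlgebra.isNondegenerateFamily_iff, ← card_sigma_ringHom_eq_sum₅₄ (K := K), isNondegenerate_iff, cmTypeRank,
    ← Embeddings.card (K i₁) ℂ]
  exact key

/-- **THE ONE-ORBIT CRITERION for an (SC) base (rank form)**: `O ⊆ Hom(K_{i₁}, ℂ)` homogeneous under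
`Aut(ℂ / x₀K_{i₀})`, compositum test off `O ∪ Ō`: additive IFF the orbit multiplicities `#{y ∈ O : g ∘ y ∈ Φ₁}` are NOT
`a` when `g ∘ x₀ ∈ Φ₀`, `b` otherwise, with `a ≠ b`. [cite: Gordon1999HodgeAVSurvey, §3 Theorem (1), 7.5–7.7 and 9.4.3]
[cite: Dodson1984, §5.1.2] -/
theorem cmFamilyRank_add_card_eq_iff_of_stabConj_of_orbit (hI : ∀ i, i = i₀ ∨ i = i₁) (h01 : i₀ ≠ i₁)
    (hSC : ∀ x₀ x : K i₀ →+* ℂ, x ≠ x₀ → x ≠ (starRingAut : ℂ ≃+* ℂ) • x₀ →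
      ∃ σ : ℂ ≃+* ℂ, σ • x₀ = x₀ ∧ σ • x = (starRingAut : ℂ ≃+* ℂ) • x)
    {x₀ : K i₀ →+* ℂ} (O : Set (K i₁ →+* ℂ)) (hO : ∀ y ∈ O, ∀ y' ∈ O, ∃ g : ℂ ≃+* ℂ, g • x₀ = x₀ ∧ g • y = y')
    (hoff : ∀ y : K i₁ →+* ℂ, y ∉ O → (starRingAut : ℂ ≃+* ℂ) • y ∉ O →
      ∃ σ : ℂ ≃+* ℂ, σ • x₀ = (starRingAut : ℂ ≃+* ℂ) • x₀ ∧ σ • y = y) :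
    CMAlgebra.cmFamilyRank Φ + Fintype.card I = (∑ i, cmTypeRank (Φ i)) + 1 ↔
      ¬ ∃ a b : ℕ, a ≠ b ∧ ∀ g : ℂ ≃+* ℂ,
        (Finset.univ.filter fun y : K i₁ →+* ℂ => y ∈ O ∧ g • y ∈ (Φ i₁).1).card =
          if g • x₀ ∈ (Φ i₀).1 then a else b := by
  haveI : Nonempty I := ⟨i₀⟩
  exact Shadow.typeRank_sigmaType_add_card_eq_iff_not_exists_orbitMultiplicities (G := ℂ ≃+* ℂ)
    (Φ := fun i => (Φ i).1) (fun i => isCMTypeWith_conj (Φ i)) hI h01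
    (irreducible_and_isNondegenerate_of_stabConj Φ hSC).1 O hO hoff

/-- **THE ONE-ORBIT CRITERION for an (SC) base (nondegeneracy form)**: the pair is nondegenerate IFF `Φ₁` is
nondegenerate and its orbit multiplicities on `O` are not constant-unequal.
[cite: Gordon1999HodgeAVSurvey, 7.5–7.7 and 9.4.3] [cite: Dodson1984, §5.1.2] -/
theorem isNondegenerateFamily_iff_of_stabConj_of_orbit (hI : ∀ i, i = i₀ ∨ i = i₁) (h01 : i₀ ≠ i₁)
    (hSC : ∀ x₀ x : K i₀ →+* ℂ, x ≠ x₀ → x ≠ (starRingAut : ℂ ≃+* ℂ) • x₀ →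
      ∃ σ : ℂ ≃+* ℂ, σ • x₀ = x₀ ∧ σ • x = (starRingAut : ℂ ≃+* ℂ) • x)
    {x₀ : K i₀ →+* ℂ} (O : Set (K i₁ →+* ℂ)) (hO : ∀ y ∈ O, ∀ y' ∈ O, ∃ g : ℂ ≃+* ℂ, g • x₀ = x₀ ∧ g • y = y')
    (hoff : ∀ y : K i₁ →+* ℂ, y ∉ O → (starRingAut : ℂ ≃+* ℂ) • y ∉ O →
      ∃ σ : ℂ ≃+* ℂ, σ • x₀ = (starRingAut : ℂ ≃+* ℂ) • x₀ ∧ σ • y = y) :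
    CMAlgebra.IsNondegenerateFamily Φ ↔ IsNondegenerate (Φ i₁) ∧
      ¬ ∃ a b : ℕ, a ≠ b ∧ ∀ g : ℂ ≃+* ℂ,
        (Finset.univ.filter fun y : K i₁ →+* ℂ => y ∈ O ∧ g • y ∈ (Φ i₁).1).card =
          if g • x₀ ∈ (Φ i₀).1 then a else b := by
  haveI := isPretransitive_ringEquiv_complex (K := K i₀)
  haveI : Nonempty I := ⟨i₀⟩
  have hnd₀ : typeRank (ℂ ≃+* ℂ) (Φ i₀).1 = Fintype.card (K i₀ →+* ℂ) / 2 + 1 :=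
    StabConj.typeRank_eq_of_stabConj (isCMTypeWith_conj (Φ i₀)) hSC
  have key := Shadow.typeRank_sigmaType_eq_iff_not_exists_orbitMultiplicities (G := ℂ ≃+* ℂ)
    (Φ := fun i => (Φ i).1) (fun i => isCMTypeWith_conj (Φ i)) hI h01
    (irreducible_and_isNondegenerate_of_stabConj Φ hSC).1 hnd₀ O hO hoff
  rw [CMAlgebra.isNondegenerateFamily_iff, ← card_sigma_ringHom_eq_sum₅₄ (K := K), isNondegenerate_iff, cmTypeRank,
    ← Embeddings.card (K i₁) ℂ]
  exact key

end Orbit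

/-! ### §3 Smaller partners -/

section Smaller

/-- **An (SC) field against ANY field of smaller degree: no common constituent** (both orders): `U(Φ_i)` is irreducible
of dimension `[K_i:ℚ]/2 > [K_j:ℚ]/2 ≥ dim U(Φ_j)` — criterion (α) of the tree.
[cite: Gordon1999HodgeAVSurvey, §3 Theorem (proof)] [cite: Serre1977, §2.2] -/
theorem pairwise_of_stabConj_of_finrank_lt (Φ : ∀ i, CMType (K i)) {i j : I}
    (hSC : ∀ x₀ x : K i →+* ℂ, x ≠ x₀ → x ≠ (starRingAut : ℂ ≃+* ℂ) • x₀ →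
      ∃ σ : ℂ ≃+* ℂ, σ • x₀ = x₀ ∧ σ • x = (starRingAut : ℂ ≃+* ℂ) • x)
    (hlt : finrank ℚ (K j) < finrank ℚ (K i)) :
    (∀ P : Submodule ℚ ((K j →+* ℂ) → ℚ), P ≤ antiSpan (ℂ ≃+* ℂ) (Φ j).1 →
      (∀ g : ℂ ≃+* ℂ, ∀ f ∈ P, (fun x => f (g • x)) ∈ P) →
      ∀ T : ((K j →+* ℂ) → ℚ) →ₗ[ℚ] ((K i →+* ℂ) → ℚ),
        (∀ g : ℂ ≃+* ℂ, ∀ f ∈ P, T (fun x => f (g • x)) = fun y => T f (g • y)) →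
        (∀ f ∈ P, T f ∈ antiSpan (ℂ ≃+* ℂ) (Φ i).1) → (∀ f ∈ P, T f = 0 → f = 0) → P = ⊥) ∧
    (∀ P : Submodule ℚ ((K i →+* ℂ) → ℚ), P ≤ antiSpan (ℂ ≃+* ℂ) (Φ i).1 →
      (∀ g : ℂ ≃+* ℂ, ∀ f ∈ P, (fun x => f (g • x)) ∈ P) →
      ∀ T : ((K i →+* ℂ) → ℚ) →ₗ[ℚ] ((K j →+* ℂ) → ℚ),
        (∀ g : ℂ ≃+* ℂ, ∀ f ∈ P, T (fun x => f (g • x)) = fun y => T f (g • y)) →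
        (∀ f ∈ P, T f ∈ antiSpan (ℂ ≃+* ℂ) (Φ j).1) → (∀ f ∈ P, T f = 0 → f = 0) → P = ⊥) := by
  obtain ⟨hirr, hdim, -⟩ := irreducible_and_isNondegenerate_of_stabConj Φ hSC
  have hi2 := Literature.AlgebraicGeometry.Motives.HodgeStructure.two_mul_ncard_cmType_eq_finrank (Φ i)
  have hlt' : finrank ℚ (antiSpan (ℂ ≃+* ℂ) (Φ j).1) < finrank ℚ (antiSpan (ℂ ≃+* ℂ) (Φ i).1) := by
    have h1 := finrank_antiSpan_le_finrank_div_two (Φ := Φ) j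
    rw [hdim]; omega
  exact pairwise_of_irreducible_of_finrank_le (G := ℂ ≃+* ℂ) (Φ := fun i => (Φ i).1) hirr hlt'.le
    (fun h => absurd h hlt'.ne)

variable [Fintype I] [DecidableEq I]

/-- **Two slots, an (SC) field against any CM field of smaller degree: nondegenerate iff the smaller type is** — an (SC)
field of degree `2n` pairs additively with EVERY CM abelian variety of dimension `< n` (no shared-subfield clause: an (SC)
field of degree `≥ 4` has no imaginary quadratic subfield to share). [cite: Gordon1999HodgeAVSurvey, §3 Theorem and 7.5–7.7] -/
theorem isNondegenerateFamily_iff_of_stabConj_of_finrank_lt {i₀ i₁ : I} (h01 : i₀ ≠ i₁)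
    (hI : ∀ j, j = i₀ ∨ j = i₁)
    (hSC : ∀ x₀ x : K i₀ →+* ℂ, x ≠ x₀ → x ≠ (starRingAut : ℂ ≃+* ℂ) • x₀ →
      ∃ σ : ℂ ≃+* ℂ, σ • x₀ = x₀ ∧ σ • x = (starRingAut : ℂ ≃+* ℂ) • x)
    (hlt : finrank ℚ (K i₁) < finrank ℚ (K i₀)) (Φ : ∀ i, CMType (K i)) :
    CMAlgebra.IsNondegenerateFamily Φ ↔ IsNondegenerate (Φ i₁) := by
  haveI : Nonempty I := ⟨i₀⟩
  have hnd₀ := (irreducible_and_isNondegenerate_of_stabConj Φ hSC).2.2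
  have hab := pairwise_of_stabConj_of_finrank_lt Φ hSC hlt
  rw [isNondegenerateFamily_iff_forall_of_pairwise Φ fun i j hij => ?_]
  · refine ⟨fun H => H i₁, fun H i => ?_⟩
    rcases hI i with rfl | rfl
    · exact hnd₀
    · exact H
  · rcases hI i with rfl | rfl <;> rcases hI j with rfl | rfl
    · exact absurd rfl hij
    · exact hab.2
    · exact hab.1
    · exact absurd rfl hij

end Smaller

/-! ### §4 Abelian varieties -/

section Varieties

variable [Fintype I] [DecidableEq I] [Nonempty I] {Φ : ∀ i, CMType (K i)} {i₀ i₁ : I} {A : I → AbelianVariety ℂ}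
  {ι : ∀ i, 𝓞 (K i) →+* End (A i)} {θ : ∀ i, K i →+* Module.End ℂ (complexBetti (A i).X 1)}

/-- **The Hodge conjecture on every `A₀^a × A₁^b`** (every `⨁_{j<N} A_{π j}`), with `B• = D•` there, for a realisation of a
type of an (SC) field and a realisation of a NONDEGENERATE type of ANY CM field whose orbit multiplicities on a
homogeneous `O` (compositum test off `O ∪ Ō`) are not constant-unequal — UNCONDITIONALLY.
[cite: Gordon1999HodgeAVSurvey, 7.5 and 10.10] -/
theorem hodgeConjectureFor_prod_of_stabConj_of_orbit (hI : ∀ i, i = i₀ ∨ i = i₁) (h01 : i₀ ≠ i₁)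
    (hSC : ∀ x₀ x : K i₀ →+* ℂ, x ≠ x₀ → x ≠ (starRingAut : ℂ ≃+* ℂ) • x₀ →
      ∃ σ : ℂ ≃+* ℂ, σ • x₀ = x₀ ∧ σ • x = (starRingAut : ℂ ≃+* ℂ) • x)
    {x₀ : K i₀ →+* ℂ} (O : Set (K i₁ →+* ℂ)) (hO : ∀ y ∈ O, ∀ y' ∈ O, ∃ g : ℂ ≃+* ℂ, g • x₀ = x₀ ∧ g • y = y')
    (hoff : ∀ y : K i₁ →+* ℂ, y ∉ O → (starRingAut : ℂ ≃+* ℂ) • y ∉ O →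
      ∃ σ : ℂ ≃+* ℂ, σ • x₀ = (starRingAut : ℂ ≃+* ℂ) • x₀ ∧ σ • y = y)
    (hnd : IsNondegenerate (Φ i₁))
    (hN : ¬ ∃ a b : ℕ, a ≠ b ∧ ∀ g : ℂ ≃+* ℂ,
      (Finset.univ.filter fun y : K i₁ →+* ℂ => y ∈ O ∧ g • y ∈ (Φ i₁).1).card =
        if g • x₀ ∈ (Φ i₀).1 then a else b)
    (hA : ∀ i, IsCMTypeRealisation (Φ i) (A i) (ι i) (θ i)) {N : ℕ} (π : Fin N → I) :
    HodgeConjectureFor (⨁ fun j : Fin N => A (π j)).dim (⨁ fun j : Fin N => A (π j)).X ∧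
      ∀ m : ℕ, hodgeClassSpan (⨁ fun j : Fin N => A (π j)).dim (⨁ fun j : Fin N => A (π j)).X m =
        divisorClassesSpan (⨁ fun j : Fin N => A (π j)).X (⨁ fun j : Fin N => A (π j)).dim m :=
  have h := (isNondegenerateFamily_iff_of_stabConj_of_orbit hI h01 hSC O hO hoff).2 ⟨hnd, hN⟩
  ⟨h.hodgeConjectureFor_prod hA π, fun m => h.hodgeClassSpan_prod_eq_divisorClassesSpan hA π m⟩

/-- **The Hodge conjecture on every `A₀^a × A₁^b`**, with `B• = D•`, for a realisation of a type of an (SC) field and a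
realisation of a NONDEGENERATE type of ANY CM field with NO coefficient vector — UNCONDITIONALLY.
[cite: Gordon1999HodgeAVSurvey, 7.5 and 10.10] -/
theorem hodgeConjectureFor_prod_of_stabConj_of_not_exists_coeff (hI : ∀ i, i = i₀ ∨ i = i₁) (h01 : i₀ ≠ i₁)
    (hSC : ∀ x₀ x : K i₀ →+* ℂ, x ≠ x₀ → x ≠ (starRingAut : ℂ ≃+* ℂ) • x₀ →
      ∃ σ : ℂ ≃+* ℂ, σ • x₀ = x₀ ∧ σ • x = (starRingAut : ℂ ≃+* ℂ) • x) (x₀ : K i₀ →+* ℂ)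
    (hnd : IsNondegenerate (Φ i₁))
    (hnot : ¬ ∃ lam : (K i₁ →+* ℂ) → ℚ, ∀ g : ℂ ≃+* ℂ,
      ∑ y, lam y * antiVec (Φ i₁).1 (1 : ℂ ≃+* ℂ) (g • y) = antiVec (Φ i₀).1 (1 : ℂ ≃+* ℂ) (g • x₀))
    (hA : ∀ i, IsCMTypeRealisation (Φ i) (A i) (ι i) (θ i)) {N : ℕ} (π : Fin N → I) :
    HodgeConjectureFor (⨁ fun j : Fin N => A (π j)).dim (⨁ fun j : Fin N => A (π j)).X ∧
      ∀ m : ℕ, hodgeClassSpan (⨁ fun j : Fin N => A (π j)).dim (⨁ fun j : Fin N => A (π j)).X m =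
        divisorClassesSpan (⨁ fun j : Fin N => A (π j)).X (⨁ fun j : Fin N => A (π j)).dim m :=
  have h := (isNondegenerateFamily_iff_not_exists_coeff_of_stabConj hI h01 hSC x₀).2 ⟨hnd, hnot⟩
  ⟨h.hodgeConjectureFor_prod hA π, fun m => h.hodgeClassSpan_prod_eq_divisorClassesSpan hA π m⟩

/-- **The Hodge conjecture on every `A^a × B^b`** — `A = A_{i₀}` with CM by an (SC) field, `B = A_{i₁}` any realisation
of a NONDEGENERATE type of a CM field of smaller degree: the Hodge conjecture and `B• = D•` on every `⨁_{j<N} A_{π j}`,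
UNCONDITIONALLY, with no hypothesis relating the two fields. [cite: Gordon1999HodgeAVSurvey, §3 Theorem and 10.10] -/
theorem hodgeConjectureFor_prod_of_stabConj_of_dim_lt (hI : ∀ i, i = i₀ ∨ i = i₁) (h01 : i₀ ≠ i₁)
    (hSC : ∀ x₀ x : K i₀ →+* ℂ, x ≠ x₀ → x ≠ (starRingAut : ℂ ≃+* ℂ) • x₀ →
      ∃ σ : ℂ ≃+* ℂ, σ • x₀ = x₀ ∧ σ • x = (starRingAut : ℂ ≃+* ℂ) • x)
    (hlt : finrank ℚ (K i₁) < finrank ℚ (K i₀)) (hnd : IsNondegenerate (Φ i₁))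
    (hA : ∀ i, IsCMTypeRealisation (Φ i) (A i) (ι i) (θ i)) {N : ℕ} (π : Fin N → I) :
    HodgeConjectureFor (⨁ fun j : Fin N => A (π j)).dim (⨁ fun j : Fin N => A (π j)).X ∧
      ∀ m : ℕ, hodgeClassSpan (⨁ fun j : Fin N => A (π j)).dim (⨁ fun j : Fin N => A (π j)).X m =
        divisorClassesSpan (⨁ fun j : Fin N => A (π j)).X (⨁ fun j : Fin N => A (π j)).dim m :=
  have h := (isNondegenerateFamily_iff_of_stabConj_of_finrank_lt h01 hI hSC hlt Φ).2 hnd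
  ⟨h.hodgeConjectureFor_prod hA π, fun m => h.hodgeClassSpan_prod_eq_divisorClassesSpan hA π m⟩

/-- **SIMPLE, NON-ISOGENOUS realisations ((SC) field against any CM field, one orbit): `B• = D•` on ALL products
`A₀^a × A₁^b` IFF `Φ₁` is nondegenerate and its orbit multiplicities are not constant-unequal**; otherwise some product
carries an exceptional Hodge class. [cite: Gordon1999HodgeAVSurvey, 7.5, 7.6.1 and 9.4.3] -/
theorem forall_prod_hodgeClassSpan_eq_iff_of_stabConj_of_orbit (hI : ∀ i, i = i₀ ∨ i = i₁) (h01 : i₀ ≠ i₁)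
    (hSC : ∀ x₀ x : K i₀ →+* ℂ, x ≠ x₀ → x ≠ (starRingAut : ℂ ≃+* ℂ) • x₀ →
      ∃ σ : ℂ ≃+* ℂ, σ • x₀ = x₀ ∧ σ • x = (starRingAut : ℂ ≃+* ℂ) • x)
    {x₀ : K i₀ →+* ℂ} (O : Set (K i₁ →+* ℂ)) (hO : ∀ y ∈ O, ∀ y' ∈ O, ∃ g : ℂ ≃+* ℂ, g • x₀ = x₀ ∧ g • y = y')
    (hoff : ∀ y : K i₁ →+* ℂ, y ∉ O → (starRingAut : ℂ ≃+* ℂ) • y ∉ O →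
      ∃ σ : ℂ ≃+* ℂ, σ • x₀ = (starRingAut : ℂ ≃+* ℂ) • x₀ ∧ σ • y = y)
    (hA : ∀ i, IsCMTypeRealisation (Φ i) (A i) (ι i) (θ i)) (hs : ∀ i, (A i).IsSimple)
    (hniso : ∀ i i', i ≠ i' → ¬ AbelianVariety.IsIsogenous (A i) (A i')) :
    (∀ (N : ℕ) (π : Fin N → I) (m : ℕ),
      hodgeClassSpan (⨁ fun j : Fin N => A (π j)).dim (⨁ fun j : Fin N => A (π j)).X m =
        divisorClassesSpan (⨁ fun j : Fin N => A (π j)).X (⨁ fun j : Fin N => A (π j)).dim m) ↔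
      IsNondegenerate (Φ i₁) ∧ ¬ ∃ a b : ℕ, a ≠ b ∧ ∀ g : ℂ ≃+* ℂ,
        (Finset.univ.filter fun y : K i₁ →+* ℂ => y ∈ O ∧ g • y ∈ (Φ i₁).1).card =
          if g • x₀ ∈ (Φ i₀).1 then a else b := by
  rw [← CMAlgebra.isNondegenerateFamily_iff_forall_prod_hodgeClassSpan_eq
    (CMAlgebra.isSeparatingFamily_of_isSimple_of_pairwise_not_isIsogenous hA hs hniso) hA]
  exact isNondegenerateFamily_iff_of_stabConj_of_orbit hI h01 hSC O hO hoff

/-- **SIMPLE, NON-ISOGENOUS realisations ((SC) field against any CM field): `B• = D•` on ALL products `A₀^a × A₁^b`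
IFF `Φ₁` is nondegenerate and no coefficient vector exists.** [cite: Gordon1999HodgeAVSurvey, 7.5 and 7.6.1] -/
theorem forall_prod_hodgeClassSpan_eq_iff_of_stabConj_coeff (hI : ∀ i, i = i₀ ∨ i = i₁) (h01 : i₀ ≠ i₁)
    (hSC : ∀ x₀ x : K i₀ →+* ℂ, x ≠ x₀ → x ≠ (starRingAut : ℂ ≃+* ℂ) • x₀ →
      ∃ σ : ℂ ≃+* ℂ, σ • x₀ = x₀ ∧ σ • x = (starRingAut : ℂ ≃+* ℂ) • x) (x₀ : K i₀ →+* ℂ)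
    (hA : ∀ i, IsCMTypeRealisation (Φ i) (A i) (ι i) (θ i)) (hs : ∀ i, (A i).IsSimple)
    (hniso : ∀ i i', i ≠ i' → ¬ AbelianVariety.IsIsogenous (A i) (A i')) :
    (∀ (N : ℕ) (π : Fin N → I) (m : ℕ),
      hodgeClassSpan (⨁ fun j : Fin N => A (π j)).dim (⨁ fun j : Fin N => A (π j)).X m =
        divisorClassesSpan (⨁ fun j : Fin N => A (π j)).X (⨁ fun j : Fin N => A (π j)).dim m) ↔
      IsNondegenerate (Φ i₁) ∧ ¬ ∃ lam : (K i₁ →+* ℂ) → ℚ, ∀ g : ℂ ≃+* ℂ,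
        ∑ y, lam y * antiVec (Φ i₁).1 (1 : ℂ ≃+* ℂ) (g • y) = antiVec (Φ i₀).1 (1 : ℂ ≃+* ℂ) (g • x₀) := by
  rw [← CMAlgebra.isNondegenerateFamily_iff_forall_prod_hodgeClassSpan_eq
    (CMAlgebra.isSeparatingFamily_of_isSimple_of_pairwise_not_isIsogenous hA hs hniso) hA]
  exact isNondegenerateFamily_iff_not_exists_coeff_of_stabConj hI h01 hSC x₀

end Varieties

end Summit.HodgeConjecture.CorCM

end
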